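import Summits.CriticalPhenomena.CardyFormulaZ2.Theses.CardySelfRefinement
import Literature.Probability.LatticeModels.UnitDiscDiscretisation
import Literature.Probability.LatticeModels.DobrushinDiscretisationBridge
import HarnessLib

/-!
# `LagHandOff` (route `CardySelfRefinement`, stmt-CriticalPhenomena-10268): the two guards of its
# convergence clause are LOAD-BEARING

Negative lemmas of the standing adversary (refuter `cdisprove`) for clause (ii) of the crux
(`… ∃ φ P, IsLocalMarkovChordalFamily P ∧ no-tracing ∧ ∀ D E, ZdDiscretisationFamily D E →
interfaces at meshes δ_{φ n} → P D in law`):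

* `clauseII_false_without_discretisation_guard` — with the admissibility guard
  `ZdDiscretisationFamily D E →` DROPPED from the convergence requirement, (ii) is FALSE: for the
  empty discrete data `⟨∅, δ, ∅, ∅⟩` the interface is G02's junk constant curve `0`
  (`bondInterfaceIn_emptyData`), whose Dirac law cannot converge to a chordal law of the unit
  disc (`‖a‖ = 1 ≠ 0`).  Any proof of (ii) must USE admissibility of `E δ` — it is the only
  source of information about `bondInterfaceIn`.
* `clauseII_false_without_mesh_positivity` — with the guard `∀ n, 0 < δs n` DROPPED, (ii) is
  FALSE even WITH the admissibility guard (so the convergence clause is not vacuous): at mesh `0`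
  every medial point is the origin, so the interface of ANY data is the constant curve `0`
  (`bondInterfaceIn_mesh_zero`); take `δs ≡ 0` and the genuine discretisation family
  `UnitDiscDiscretisation.discData` of the unit disc.

Companions: `Negative/Structure.lean`, `Negative/KillTemplates.lean`; work file
`Cruxes/LagHandOff/Disproof.lean`.
-/

noncomputable section

open MeasureTheory Filter Set Topology
open Literature.Probability.Percolation Literature.Probability.LatticeModels
open Literature.Probability.RandomPlanarGeometry Literature.Probability.Percolation.QuadCrossing
open Summit.CriticalPhenomena.CardyFormulaZ2.Theses.CardySelfRefinement

namespace Summit.CriticalPhenomena.CardyFormulaZ2.Theorems.LagHandOff.Negative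

/-! ### Load-bearing guard 1: admissibility `ZdDiscretisationFamily D E` -/

/-- The mesh domain of the empty set is empty. [folklore] -/
theorem meshDomain_empty (δ : ℝ) : meshDomain (∅ : Set ℂ) δ = ∅ := by
  apply Set.eq_empty_of_subset_empty
  intro x hx
  have := meshDomain_subset_meshVertices _ _ hx
  simp at this

/-- The discrete domain graph of the empty set has no edges. [folklore] -/
theorem not_adj_discreteDomainGraph_empty (δ : ℝ) (x y : Site 2) :
    ¬ (discreteDomainGraph (∅ : Set ℂ) δ).Adj x y := fun h => by
  have := (discreteDomainGraph_adj_iff.1 h).2.1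
  rw [meshDomain_empty] at this
  exact this

/-- The EMPTY discrete Dobrushin data `⟨∅, δ, ∅, ∅⟩` (no domain, no arcs) have no `A`–`B` edge
(so they are not admissible). [folklore] -/
theorem zdABEdges_emptyData (δ : ℝ) : (⟨∅, δ, ∅, ∅⟩ : DiscreteDobrushin).zdABEdges = ∅ := by
  apply Set.eq_empty_of_subset_empty
  intro e he
  rw [DiscreteDobrushin.mem_zdABEdges_iff] at he
  obtain ⟨he, -, -⟩ := he
  revert he
  refine Sym2.ind (fun x y hxy => ?_) e
  exact not_adj_discreteDomainGraph_empty δ x y ((SimpleGraph.mem_edgeSet _).1 hxy)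

/-- The empty data admit no exploration path. [folklore] -/
theorem not_isMedialExploration_emptyData (δ : ℝ) (ω : BondConfig (Site 2))
    (γ : List MedialVertex) : ¬ IsMedialExploration (⟨∅, δ, ∅, ∅⟩ : DiscreteDobrushin) ω γ :=
  fun h => by
  have := h.head_mem
  rw [zdABEdges_emptyData] at this
  exact this

/-- So G02's exploration of the empty data is the junk value `[]`. [folklore] -/
theorem medialExploration_emptyData (δ : ℝ) (ω : BondConfig (Site 2)) :
    medialExploration (⟨∅, δ, ∅, ∅⟩ : DiscreteDobrushin) ω = [] := by
  unfold medialExploration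
  rw [dif_neg]
  rintro ⟨γ, hγ, -⟩
  exact not_isMedialExploration_emptyData δ ω γ hγ

/-- And its polyline is the constant curve `0`. [folklore] -/
theorem medialExplorationCurve_emptyData (δ : ℝ) (ω : BondConfig (Site 2)) :
    medialExplorationCurve (⟨∅, δ, ∅, ∅⟩ : DiscreteDobrushin) ω = ContinuousMap.const _ 0 := by
  simp [medialExplorationCurve, medialExploration_emptyData]

/-- Reversing a constant parametrised curve. [folklore] -/
theorem reverseCurve_const {E : Type*} [TopologicalSpace E] (x : E) :
    reverseCurve (ContinuousMap.const unitInterval x) = ContinuousMap.const unitInterval x := by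
  ext t; simp

/-- Orienting a constant parametrised curve. [folklore] -/
theorem orientCurve_const (D : DobrushinDomain) (x : ℂ) :
    orientCurve D (ContinuousMap.const unitInterval x) = Curve.const x := by
  rcases orientCurve_eq_or D (ContinuousMap.const unitInterval x) with h | h
  · rw [h]; rfl
  · rw [h, reverseCurve_const]; rfl

/-- Off admissible data the interface is G02's junk: for the empty data it is the class of the
constant curve `0`, whatever the configuration. [folklore] -/
theorem bondInterfaceIn_emptyData (D : DobrushinDomain) (δ : ℝ) (ω : BondConfig (Site 2)) :
    bondInterfaceIn D (⟨∅, δ, ∅, ∅⟩ : DiscreteDobrushin) ω = CurveClass.mk (Curve.const 0) := by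
  rw [bondInterfaceIn_apply, medialExplorationCurve_emptyData, orientCurve_const]

/-- The marked points of the unit disc have norm `1`. [folklore] -/
theorem norm_pt_unitDisc (i : Fin 2) : ‖DobrushinDomain.unitDisc.pt i‖ = 1 := by
  have h := DobrushinDomain.unitDisc.pt_mem_frontier i
  have hc : DobrushinDomain.unitDisc.carrier = Metric.ball (0 : ℂ) 1 := rfl
  rw [hc, frontier_ball (0 : ℂ) one_ne_zero] at h
  simpa using h

/-- **LOAD-BEARING GUARD 1.**  Clause (ii) of `LagHandOff` with the admissibility guard
`ZdDiscretisationFamily D E →` DROPPED from its convergence requirement is FALSE.  Witness: the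
unit disc, the empty discrete data `E δ = ⟨∅, δ, ∅, ∅⟩` (interface ≡ class of the constant curve
`0`) and the test functional `γ ↦ min 1 (dist γ.source a)`, `a = unitDisc.pt 0`, `‖a‖ = 1`: the
discrete side is constantly `1`, the continuum side vanishes since `P D` is chordal.  So any proof
of (ii) must use admissibility of `E δ`. [folklore] -/
theorem clauseII_false_without_discretisation_guard :
    ¬ (∀ δs : ℕ → ℝ, (∀ n, 0 < δs n) → Tendsto δs atTop (𝓝 0) →
        ∃ φ : ℕ → ℕ, StrictMono φ ∧ ∃ P : ChordalFamily, IsLocalMarkovChordalFamily P ∧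
          (∀ D : DobrushinDomain, ∀ᵐ γ ∂(P D), ∀ c : Curve ℂ, CurveClass.mk c = γ →
            ∀ s t : unitInterval, s < t → c '' Set.Icc s t ⊆ frontier D.carrier →
              (c '' Set.Icc s t).Subsingleton) ∧
          (∀ (D : DobrushinDomain) (E : ℝ → DiscreteDobrushin),
            ∀ f : BoundedContinuousFunction (CurveClass ℂ) ℝ,
              Tendsto (fun n => ∫ ω, f (bondInterfaceIn D (E (δs (φ n))) ω)
                ∂(bondPercolation (zdGraph 2) half)) atTop (𝓝 (∫ γ, f γ ∂(P D))))) := by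
  intro h
  obtain ⟨φ, -, P, hP, -, hconv⟩ := h (fun n => 1 / ((n : ℝ) + 1))
    (fun n => by positivity) tendsto_one_div_add_atTop_nhds_zero_nat
  set D := DobrushinDomain.unitDisc with hD
  set f : BoundedContinuousFunction (CurveClass ℂ) ℝ :=
    BoundedContinuousFunction.ofNormedAddCommGroup (fun γ => min 1 (dist γ.source (D.pt 0)))
      (continuous_const.min (CurveClass.continuous_source.dist continuous_const)) 1
      (fun γ => by
        rw [Real.norm_eq_abs, abs_of_nonneg (le_min zero_le_one dist_nonneg)]
        exact min_le_left _ _) with hf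
  have hf_apply : ∀ γ, f γ = min 1 (dist γ.source (D.pt 0)) := fun γ => rfl
  have hlim := hconv D (fun δ => ⟨∅, δ, ∅, ∅⟩) f
  -- the discrete side is the constant `f (mk (const 0)) = 1`
  have hconst : (fun n => ∫ ω, f (bondInterfaceIn D
      ((fun δ => (⟨∅, δ, ∅, ∅⟩ : DiscreteDobrushin)) (1 / ((φ n : ℝ) + 1))) ω)
      ∂(bondPercolation (zdGraph 2) half)) = fun _ => (1 : ℝ) := by
    funext n
    have hpt : (fun ω => f (bondInterfaceIn D
        ((fun δ => (⟨∅, δ, ∅, ∅⟩ : DiscreteDobrushin)) (1 / ((φ n : ℝ) + 1))) ω)) =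
        fun _ => (1 : ℝ) := by
      funext ω
      rw [bondInterfaceIn_emptyData, hf_apply, CurveClass.source_mk, Curve.source_def,
        Curve.const_apply, dist_comm, dist_zero_right, norm_pt_unitDisc, min_self]
    rw [hpt, integral_const, probReal_univ, one_smul]
  rw [hconst] at hlim
  have h1 : ∫ γ, f γ ∂(P D) = 1 := (tendsto_nhds_unique tendsto_const_nhds hlim).symm
  -- the continuum side vanishes: a.s. `source = a`
  have h0 : ∫ γ, f γ ∂(P D) = 0 := by
    apply integral_eq_zero_of_ae
    filter_upwards [(hP.isChordal D).2] with γ hγ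
    simp [hf_apply, hγ.1]
  rw [h0] at h1
  exact zero_ne_one h1

/-! ### Load-bearing guard 2: mesh positivity `∀ n, 0 < δs n` -/

/-- A polyline all of whose vertices coincide is constant (as a set). [folklore] -/
theorem range_polylineFrom_subset_singleton {E : Type*} [AddCommGroup E] [Module ℝ E]
    [TopologicalSpace E] [ContinuousAdd E] [ContinuousSMul ℝ E] (a : E) :
    ∀ l : List E, (∀ y ∈ l, y = a) → Set.range (polylineFrom a l).2 ⊆ {a}
  | [], _ => by
    rintro _ ⟨t, rfl⟩
    simp only [polylineFrom_nil, Set.mem_singleton_iff]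
    exact Path.refl_apply a t
  | b :: l, h => by
    have hb : b = a := h b (by simp)
    subst hb
    rw [polylineFrom_cons, Path.trans_range, Path.range_segment, segment_same]
    exact Set.union_subset subset_rfl
      (range_polylineFrom_subset_singleton b l fun y hy => h y (by simp [hy]))

/-- At mesh `0` every medial point is the origin, so G02's exploration polyline is the constant
curve `0` (whatever the data and the configuration). [folklore] -/
theorem medialExplorationCurve_mesh_zero (E : DiscreteDobrushin) (hE : E.δ = 0)
    (ω : BondConfig (Site 2)) : medialExplorationCurve E ω = ContinuousMap.const _ 0 := by
  have hpt : ∀ e : MedialVertex, medialPoint E.δ e = 0 := by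
    intro e
    induction e using Sym2.ind with
    | _ x y => simp [medialPoint_mk, meshPoint, hE]
  unfold medialExplorationCurve
  cases hl : medialExploration E ω with
  | nil => simp
  | cons e l =>
    rw [List.map_cons, hpt e]
    ext t
    have hmem : (polyline ((0 : ℂ) :: l.map (medialPoint E.δ))) t ∈ ({0} : Set ℂ) := by
      refine range_polylineFrom_subset_singleton (0 : ℂ) (l.map (medialPoint E.δ)) ?_ ⟨t, rfl⟩
      intro y hy
      obtain ⟨e', -, rfl⟩ := List.mem_map.1 hy
      exact hpt e'
    simpa using hmem

/-- Hence at mesh `0` the bond interface is the class of the constant curve `0`. [folklore] -/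
theorem bondInterfaceIn_mesh_zero (D : DobrushinDomain) (E : DiscreteDobrushin) (hE : E.δ = 0)
    (ω : BondConfig (Site 2)) : bondInterfaceIn D E ω = CurveClass.mk (Curve.const 0) := by
  rw [bondInterfaceIn_apply, medialExplorationCurve_mesh_zero E hE]
  rcases orientCurve_eq_or D (ContinuousMap.const unitInterval (0 : ℂ)) with h | h
  · rw [h]; rfl
  · rw [h, reverseCurve_const]; rfl

/-- **LOAD-BEARING GUARD 2.**  Clause (ii) of `LagHandOff` with the positivity guard
`∀ n, 0 < δs n` DROPPED is FALSE, even WITH the admissibility guard (so the convergence clause of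
(ii) is not vacuous): take `δs ≡ 0` (tends to `0`), the unit disc and the genuine discretisation
family `UnitDiscDiscretisation.discData`, whose mesh-`0` member has mesh `0`, interface ≡ class of
the constant curve `0`. [folklore] -/
theorem clauseII_false_without_mesh_positivity :
    ¬ (∀ δs : ℕ → ℝ, Tendsto δs atTop (𝓝 0) →
        ∃ φ : ℕ → ℕ, StrictMono φ ∧ ∃ P : ChordalFamily, IsLocalMarkovChordalFamily P ∧
          (∀ D : DobrushinDomain, ∀ᵐ γ ∂(P D), ∀ c : Curve ℂ, CurveClass.mk c = γ →
            ∀ s t : unitInterval, s < t → c '' Set.Icc s t ⊆ frontier D.carrier →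
              (c '' Set.Icc s t).Subsingleton) ∧
          (∀ (D : DobrushinDomain) (E : ℝ → DiscreteDobrushin), ZdDiscretisationFamily D E →
            ∀ f : BoundedContinuousFunction (CurveClass ℂ) ℝ,
              Tendsto (fun n => ∫ ω, f (bondInterfaceIn D (E (δs (φ n))) ω)
                ∂(bondPercolation (zdGraph 2) half)) atTop (𝓝 (∫ γ, f γ ∂(P D))))) := by
  intro h
  obtain ⟨φ, -, P, hP, -, hconv⟩ := h (fun _ => 0) tendsto_const_nhds
  set D := DobrushinDomain.unitDisc with hD
  set f : BoundedContinuousFunction (CurveClass ℂ) ℝ :=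
    BoundedContinuousFunction.ofNormedAddCommGroup (fun γ => min 1 (dist γ.source (D.pt 0)))
      (continuous_const.min (CurveClass.continuous_source.dist continuous_const)) 1
      (fun γ => by
        rw [Real.norm_eq_abs, abs_of_nonneg (le_min zero_le_one dist_nonneg)]
        exact min_le_left _ _) with hf
  have hf_apply : ∀ γ, f γ = min 1 (dist γ.source (D.pt 0)) := fun γ => rfl
  have hE : ZdDiscretisationFamily D UnitDiscDiscretisation.discData :=
    UnitDiscDiscretisation.isDiscretisation_discData.toZdDiscretisationFamily
  have hlim := hconv D UnitDiscDiscretisation.discData hE f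
  have hconst : (fun n => ∫ ω, f (bondInterfaceIn D (UnitDiscDiscretisation.discData
      ((fun _ => (0 : ℝ)) (φ n))) ω) ∂(bondPercolation (zdGraph 2) half)) = fun _ => (1 : ℝ) := by
    funext n
    have hpt : (fun ω => f (bondInterfaceIn D (UnitDiscDiscretisation.discData
        ((fun _ => (0 : ℝ)) (φ n))) ω)) = fun _ => (1 : ℝ) := by
      funext ω
      rw [bondInterfaceIn_mesh_zero D _ rfl, hf_apply, CurveClass.source_mk, Curve.source_def,
        Curve.const_apply, dist_comm, dist_zero_right, norm_pt_unitDisc, min_self]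
    rw [hpt, integral_const, probReal_univ, one_smul]
  rw [hconst] at hlim
  have h1 : ∫ γ, f γ ∂(P D) = 1 := (tendsto_nhds_unique tendsto_const_nhds hlim).symm
  have h0 : ∫ γ, f γ ∂(P D) = 0 := by
    apply integral_eq_zero_of_ae
    filter_upwards [(hP.isChordal D).2] with γ hγ
    simp [hf_apply, hγ.1]
  rw [h0] at h1
  exact zero_ne_one h1
end Summit.CriticalPhenomena.CardyFormulaZ2.Theorems.LagHandOff.Negative

end
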